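import Summits.BirchSwinnertonDyer.BirchSwinnertonDyer.Theorems.AdditiveBranchIMCGordTwoRankOneCruxShape
import Summits.BirchSwinnertonDyer.BirchSwinnertonDyer.Theorems.AdditiveBranchIMCGordTwoRankOneCM
import Literature.NumberTheory.EllipticCurves.SkinnerUrban2014.PAdicUnitPeriodRatioAnyPrimeProofs
import Literature.NumberTheory.EllipticCurves.SkinnerUrban2014.PAdicUnitImaginaryPeriodRatioProofs
import Literature.NumberTheory.EllipticCurves.IsogenyQuadraticTwistProofs
import Literature.NumberTheory.EllipticCurves.IsogenyVariableChangeProofs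
import Literature.NumberTheory.EllipticCurves.IsogenyFrobeniusTraceProofs
import Literature.NumberTheory.EllipticCurves.ComplexMultiplicationLFunctionIsogenyHoldsProofs
import HarnessLib

/-!
# Route `AdditiveBranchIMC` (rung K1), crux `GordTwoRankOne` (item 19358): the analytic certificate
# `A′ ≠ 0` is an ISOGENY INVARIANT on cell (G-ord, `e = 2`), and the crux shape with the certificate at the
# pair (cell `bsd-addord`, seat `bsd-addord-k1-c3`, D-0074 row B2; `--supports stmt-BirchSwinnertonDyer-19358
# --as helper`; fifth file after `…GordTwoRankOne{OffCaseOne,OddBranch,ClassForm,CruxShape}.lean`)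

HONEST FRAMING. THEOREMS ONLY: no definition, no named fact, no `sorry`, nothing booked; the crux stays OPEN at
class level. `…CruxShape.lean` takes the certificate `BranchCoeffOneNeZeroAt` on the whole isogeny CLASS because
the Case-1 member `W′` (where gz's end states apply) need not be `W`. Here we prove the certificate is a
`ℚ`-isogeny invariant on the cell — so ONE number per class suffices, and it may be computed at ANY member —
and restate the crux shape with the certificate at the pair `(W, p)` itself.

* `branchCoeffOneNeZeroAt_of_isIsogenous` — `N10.CellGordTwo W p`, `W ~ W′` (globally minimal),
  `BranchCoeffOneNeZeroAt W p ⟹ BranchCoeffOneNeZeroAt W′ p`, granted modular parametrisations (`hmodD`,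
  used only for Néron lattices). Proof: the good twist models `V, V′` of `W, W′` are isogenous
  (`exists_variableChange_twist_of_model_twist`, `IsIsogenous.quadraticTwist`, `isIsogenous_of_smul_eq{,'}`),
  hence `a_p(V) = a_p(V′)` (Faltings: `frobeniusTrace_eq_of_isIsogenous`) and `α_V = α_{V′}`, `L(V,s) = L(V′,s)`
  (`LFunction_eq_of_isIsogenous_holds`, so a newform of `V′` is one of `V`), and the Néron periods differ by a
  non-zero rational (`exists_int_mul_{real,imaginary}PeriodRat_eq_of_isogeny`, Skinner–Urban §9 bookkeeping);
  the linear coefficient `[T¹](ϖ·L_p^{±}(f, α, ω^{(p−1)/2}))` is rescaled by that rational.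
* `gordTwoRankOne_of_facts_of_chiBranchLower_of_branchCoeffOneNeZero` — THE CRUX SHAPE with the per-pair
  certificate: published facts → [Λ-adic branch lower containment on the off-Case-1 slice, per parity —
  NOT in print] → ∀ `W p`, `r_an = 1 → N10.CellGordTwo W p → ¬CM → BranchCoeffOneNeZeroAt W p →
  MissingLowerBoundAt W p`.

References: [Faltings1983Endlichkeit] §5 Kor. 2; [GreenbergVatsal2000] §3 Rem. 3.4; [SilvermanAEC2009]
VI.4.1(b), X.5.4; [MazurTateTeitelbaum1986Invent] §I.11, §I.13–14; cell TARGET.md E39, row B2.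
-/

set_option autoImplicit false
set_option linter.dupNamespace false

noncomputable section

open scoped Classical MatrixGroups ModularForm NumberField

open CongruenceSubgroup WeierstrassCurve NumberField IsDedekindDomain Field
  Literature.NumberTheory.EllipticCurves Literature.NumberTheory.EllipticCurves.ModularForms
  Literature.NumberTheory.EllipticCurves.GreenbergVatsal2000
  Literature.NumberTheory.EllipticCurves.Rank1Residual
  Literature.NumberTheory.EllipticCurves.Rank1Residual.Typed
  Literature.NumberTheory.EllipticCurves.Delbourgo2002
  Literature.NumberTheory.EllipticCurves.Disegni2017
  Literature.NumberTheory.GaloisRepresentations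
  Summit.BirchSwinnertonDyer.Rank1Residual.AdditivePotMult
  Summit.BirchSwinnertonDyer.Rank1Residual.Additive

namespace Summit.BirchSwinnertonDyer.BirchSwinnertonDyer.Theorems.AdditiveBranchIMCGordTwoRankOne

variable {W : WeierstrassCurve ℚ} [W.IsElliptic] [W.IsGloballyMinimal] {p : ℕ} [hp : Fact p.Prime]

/-! ### §1 `A′ ≠ 0` is an isogeny invariant on cell (G-ord, `e = 2`) -/

/-- Bookkeeping: `[T¹](C(ϖ)·B) ≠ 0` and `ϖ = c·ϖ'` give `[T¹](C(ϖ')·B) ≠ 0`. [folklore] -/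
theorem coeff_one_C_mul_ne_zero_of_mul {ϖ ϖ' c : ℚ} {B : PowerSeries ℚ_[p]}
    (hϖ : ϖ = c * ϖ') (h : PowerSeries.coeff 1 (PowerSeries.C (ϖ : ℚ_[p]) * B) ≠ 0) :
    PowerSeries.coeff 1 (PowerSeries.C (ϖ' : ℚ_[p]) * B) ≠ 0 := by
  rw [PowerSeries.coeff_C_mul] at h ⊢
  intro h0
  apply h
  rw [hϖ, Rat.cast_mul, mul_assoc, h0, mul_zero]

omit [W.IsElliptic] [W.IsGloballyMinimal] hp in
/-- **The good twist models of isogenous (G-ord, `e = 2`) curves are isogenous**: if `C • V^{(d)} = W`,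
`C′ • V′^{(d)} = W′` (`d ≠ 0`) and `W ~ W′` over `ℚ`, then `V ~ V′` (`V ≅ W^{(d)} ~ W′^{(d)} ≅ V′`).
[cite: SilvermanAEC2009, X.5 Cor. 5.4] -/
theorem isIsogenous_of_model_twist_of_isIsogenous {W' V V' : WeierstrassCurve ℚ} {d : ℚ} (hd : d ≠ 0)
    {C C' : VariableChange ℚ} (hC : C • V.quadraticTwist d = W) (hC' : C' • V'.quadraticTwist d = W')
    (h : IsIsogenous W W') : IsIsogenous V V' := by
  haveI : NeZero (2 : ℚ) := ⟨two_ne_zero⟩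
  obtain ⟨C₁, hC₁⟩ := exists_variableChange_twist_of_model_twist V hd hC
  obtain ⟨C₁', hC₁'⟩ := exists_variableChange_twist_of_model_twist V' hd hC'
  exact IsIsogenous.trans' (IsIsogenous.trans' (isIsogenous_of_smul_eq' hC₁) (h.quadraticTwist hd))
    (isIsogenous_of_smul_eq hC₁')

/-- **`A′ ≠ 0` is a `ℚ`-isogeny invariant on cell (G-ord, `e = 2`).** For `W ~ W′` globally minimal with
`(W, p)` on `N10.CellGordTwo`, `BranchCoeffOneNeZeroAt W p → BranchCoeffOneNeZeroAt W′ p` (granted modular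
parametrisation data, `hmodD`, for the Néron lattices). At a twist datum `(V′, C′, f, ϖ′)` of `W′`: the good
ordinary twist model `V` of `W` is isogenous to `V′`, so `a_p(V) = a_p(V′)` and `unitRoot V p = unitRoot V′ p`
(Faltings), `f` is also the newform of `V` (`L(V,s) = L(V′,s)`), and `q·Ω^{±}(V) = a·Ω^{±}(V′)` with
`q, a ≠ 0` integers (Néron periods under an isogeny); the certificate of `W` at `(V, C, f, ϖ′·q/a)` is the
certificate of `W′` at `(V′, C′, f, ϖ′)` up to the factor `q/a`. [cite: Faltings1983Endlichkeit, §5 Korollar 2, (i) ⇒ (iv)]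
[cite: GreenbergVatsal2000, §3, Remark 3.4] [cite: MazurTateTeitelbaum1986Invent, §I.11, §I.13–I.14] -/
theorem branchCoeffOneNeZeroAt_of_isIsogenous (hmodD : nonempty_modularParametrizationData)
    {W' : WeierstrassCurve ℚ} (hc : N10.CellGordTwo W p) (h : IsIsogenous W W')
    (hne : BranchCoeffOneNeZeroAt W p) :
    BranchCoeffOneNeZeroAt W' p := by
  obtain ⟨hp2, haddv, hG, he⟩ := hc
  intro V' _ _ C' hC' hord' N _ f hf' ϖ' hϖ'
  -- the good ordinary twist model of `W` and `V ~ V'`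
  obtain ⟨V, iV, iVm, C, hV, hC⟩ := TypeGOrd.exists_goodOrd_pStar_twist_model W p hp2 hG haddv he
  have hVV' : IsIsogenous V V' := isIsogenous_of_model_twist_of_isIsogenous (pStar_ne_zero p) hC hC' h
  -- `a_p`, unit root, newform
  have hap : V.frobeniusTrace p = V'.frobeniusTrace p :=
    frobeniusTrace_eq_of_isIsogenous hVV' p hV.1 hord'.1
  have hα : unitRoot V p = unitRoot V' p := by
    simp only [unitRoot, hap]
  have hL : V.LFunction = V'.LFunction := LFunction_eq_of_isIsogenous_holds V V' hVV'
  have hf : IsNewformOf V f := ⟨hf'.1, fun n ↦ by rw [hf'.2 n, hL]⟩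
  -- Néron periods under the isogeny
  haveI : NeZero (V.conductorNorm ℤ) := ⟨(V.conductorNorm_pos_holds).ne'⟩
  haveI : NeZero (V'.conductorNorm ℤ) := ⟨(V'.conductorNorm_pos_holds).ne'⟩
  obtain ⟨Dm⟩ := hmodD V
  obtain ⟨Dm'⟩ := hmodD V'
  obtain ⟨ψ⟩ := hVV'
  have hdeg : (ψ.degree : ℤ) ≠ 0 := by exact_mod_cast (Isogeny.degree_pos ψ).ne'
  by_cases hev : Even (p / 2)
  · -- PLUS branch: real periods
    rw [if_pos hev] at hϖ'
    obtain ⟨q, a, b, hq0, -, hab, hqa⟩ := SkinnerUrban2014.exists_int_mul_realPeriodRat_eq_of_isogeny Dm Dm' ψ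
    have ha0 : a ≠ 0 := by
      rintro rfl
      exact hdeg (by rw [← hab, zero_mul])
    -- `(ϖ'·q/a)·Ω(V) = ϖ'·Ω(V') = Ω⁺_f`
    have hϖ : (((ϖ' * q / a : ℚ)) : ℝ) * V.realPeriodRat = plusPeriod f := by
      rw [← hϖ']
      have ha0' : (a : ℝ) ≠ 0 := by exact_mod_cast ha0
      push_cast
      field_simp
      linear_combination (ϖ' : ℝ) * hqa
    have h1 := hne V C hC ⟨hV.1, hV.2⟩ f hf (ϖ' * q / a) (by rw [if_pos hev]; exact hϖ)
    rw [if_pos hev] at h1 ⊢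
    rw [← hα]
    exact coeff_one_C_mul_ne_zero_of_mul (c := q / a) (by ring) h1
  · -- MINUS branch: imaginary periods
    rw [if_neg hev] at hϖ'
    obtain ⟨q, a, b, hq0, -, hab, hqa⟩ :=
      SkinnerUrban2014.exists_int_mul_imaginaryPeriodRat_eq_of_isogeny Dm Dm' ψ
    have ha0 : a ≠ 0 := by
      rintro rfl
      exact hdeg (by rw [← hab, zero_mul])
    have hϖ : (((ϖ' * q / a : ℚ)) : ℝ) * V.imaginaryPeriodRat = minusPeriod f := by
      rw [← hϖ']
      have ha0' : (a : ℝ) ≠ 0 := by exact_mod_cast ha0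
      push_cast
      field_simp
      linear_combination (ϖ' : ℝ) * hqa
    have h1 := hne V C hC ⟨hV.1, hV.2⟩ f hf (ϖ' * q / a) (by rw [if_neg hev]; exact hϖ)
    rw [if_neg hev] at h1 ⊢
    rw [← hα]
    exact coeff_one_C_mul_ne_zero_of_mul (c := q / a) (by ring) h1

/-- **`A′ ≠ 0` at the pair gives `A′ ≠ 0` on the class** (the binder shape of `…CruxShape.lean`).
[cite: Faltings1983Endlichkeit, §5 Korollar 2] [cite: GreenbergVatsal2000, §3, Remark 3.4] -/
theorem classCert_of_branchCoeffOneNeZeroAt (hmodD : nonempty_modularParametrizationData)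
    (hc : N10.CellGordTwo W p) (hne : BranchCoeffOneNeZeroAt W p) :
    ∀ (W' : WeierstrassCurve ℚ) [W'.IsElliptic] [W'.IsGloballyMinimal],
      IsIsogenous W W' → BranchCoeffOneNeZeroAt W' p :=
  fun _ _ _ h ↦ branchCoeffOneNeZeroAt_of_isIsogenous hmodD hc h hne

/-! ### §2 THE CRUX SHAPE with the certificate at the pair -/

/-- **Crux `GordTwoRankOne` (item 19358) MODULO its displayed inputs, certificate AT THE PAIR.** From
PUBLISHED named facts (`hW16 hGV h23 h414 hGrK hLiftF hLiftE hMaz hCyc hCyc3 hArt h73 hWald hDel hDel3 hmod hmodD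
hmodN hGZK hCassels`) and the Λ-adic branch lower containment DISPLAYED on the off-Case-1 slice (`hΛ` PLUS
branch at `p ≡ 1 (mod 4)`, `hΛ'` MINUS branch at `p ≡ 3 (mod 4)` — the rank-free Λ-adic layer of items
19244/19245; NOT in print, NOT asserted): for every globally minimal `E/ℚ` of analytic rank `1` and every
(G-ord, `e = 2`) additive odd prime `p` (any residual image, anomalous or not, Case-1 class or not), IF `E` is
non-CM and `A′(E,p) ≠ 0` (`BranchCoeffOneNeZeroAt W p`: the Néron-normalised `ω^{(p−1)/2}`-branch of the good
twist has a SIMPLE zero — one computable number, = Schneider's non-degeneracy for the datum), THEN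
`ord_p #Ш(E)_an ≤ ord_p #Ш(E)`. = `gordTwoRankOne_of_facts_of_chiBranchLower_of_classCert` ∘ §1. Against the
route decl the residual inputs are EXACTLY {hΛ, hΛ′} (crux 19357's layer), ¬CM, and the per-pair certificate
(rider I1; H3: not attacked). Nothing booked. [cite: Delbourgo2002, Theorem (A), (B) (p. 40), p. 67 (iv), p. 69]
[cite: Disegni2017, Theorem A/B (arXiv v3 PDF 7–9)] [cite: Mazur1972Towers, Cor. 5.15] [cite: MilneADT2006, Thm. I.7.3]
[cite: SkinnerUrban2014, Cor. 3.6.3, Thm. 3.6.4 (pp. 42–43) (shape only; nothing asserted)] [cite: Miller2011LMS, Def. 1.1] -/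
theorem gordTwoRankOne_of_facts_of_chiBranchLower_of_branchCoeffOneNeZero
    (hW16 : Wuthrich2014.thm16_halfEigenCharIdeal_dvd_cyclotomicPrime)
    (hGV : thm312_branch_unitContent_and_lambda_eq_residual_goodOrd)
    (h23 : datumSelmer_nonPrimitive_invariants)
    (h414 : Greenberg1999.prop414_noFiniteSubmodule_of_not_dvd_torsionOrder)
    (hGrK : Greenberg1999.imKummer_ge_strictCondition_goodOrdinary)
    (hLiftF : residualEpsilon_surjOn_of_lineRamifiedEven) (hLiftE : residualEpsilon_surjOn_of_lineEven)
    (hMaz : Mazur1972.cor515_universalNormIndex) (hCyc : delbourgoDatum_cycLineGrossZagier)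
    (hCyc3 : delbourgoDatum_cycLineGrossZagier_intrinsicThree)
    (hArt : rankinSelbergEulerProductHecke_baseChangeDirichlet_eq) (h73 : GrossZagier1986_thm_I_7_3)
    (hWald : waldspurger_exists_heegnerField_twist_ne_zero) (hDel : Delbourgo2002.mainTheorem)
    (hDel3 : Delbourgo2002.mainTheorem_three)
    (hmod : hasEntireLFunction_rat) (hmodD : nonempty_modularParametrizationData)
    (hmodN : exists_isNewformOf) (hGZK : rank_eq_analyticRank_of_analyticRank_le_one)
    (hCassels : bsdRHS_eq_of_isIsogenous)
    (hΛ : ∀ (W : WeierstrassCurve ℚ) [W.IsElliptic] [W.IsGloballyMinimal] (p : ℕ) [Fact p.Prime],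
      N10.CellGordTwo W p → ¬ HasCaseOneMember W p → p % 4 = 1 → ChiBranchLowerDivisibilityAt W p)
    (hΛ' : ∀ (W : WeierstrassCurve ℚ) [W.IsElliptic] [W.IsGloballyMinimal] (p : ℕ) [Fact p.Prime],
      N10.CellGordTwo W p → ¬ HasCaseOneMember W p → p % 4 = 3 → ChiBranchLowerDivisibilityOddAt W p) :
    ∀ (W : WeierstrassCurve ℚ) [W.IsElliptic] [W.IsGloballyMinimal] (p : ℕ) [Fact p.Prime],
      W.analyticRank = 1 → N10.CellGordTwo W p → ¬ W.HasCM → BranchCoeffOneNeZeroAt W p →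
      MissingLowerBoundAt W p :=
  fun W _ _ p _ hr hc hcm hne ↦
    gordTwoRankOne_of_facts_of_chiBranchLower_of_classCert hW16 hGV h23 h414 hGrK hLiftF hLiftE hMaz hCyc hCyc3
      hArt h73 hWald hDel hDel3 hmod hmodD hmodN hGZK hCassels hΛ hΛ' W p hr hc hcm
      (classCert_of_branchCoeffOneNeZeroAt hmodD hc hne)

/-! ### §3 (appended) X3♯(G-ord) ∩ `I₀*`, Case-1 member OR NOT: `BSD(E,p)` from the per-pair Λ-adic
input + Wuthrich's half — the reducible twin of the X4 ∩ surj theorems of `…OffCaseOne/OddBranch/CruxShape` -/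

/-- **X3♯(G-ord) ∩ `I₀*` (`E[p]` reducible, `e = 2`), `p ≡ 1 (mod 4)`, non-CM, `r_an = 1`, anomalous or
not, line datum OR NOT (so the no-Case-1 "μ-territory" classes included): `BSD(E,p)` from the per-pair Λ-adic
branch lower containment `ChiBranchLowerDivisibilityAt W p` (DISPLAYED — NOT in print off the Case-1 rows),
PUBLISHED named facts (`hW16` Wuthrich 2014 Thm. 16 half for the upper bound; `hMaz`, `hCyc`, `hArt`, `h73`,
`hWald`, `hDel`, modularity, GZK) and `BranchCoeffOneNeZeroAt W p`.** Chain: twist model; §1 of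
`…OffCaseOne` (datum + identity); lower = its model-keyed core; Schneider; upper = gz's
`ClassX3Gord.missingUpperBoundAt_rankOne_of_wuthrichHalf_of_identity`; glue. Nothing booked.
[cite: Wuthrich2014, Thm. 16 (p. 397)] [cite: Delbourgo2002, Theorem (A), (B) (p. 40), p. 67 (iv), p. 69]
[cite: Mazur1972Towers, Cor. 5.15] [cite: Disegni2017, Theorem A/B (arXiv v3 PDF 7–9)] [cite: Miller2011LMS, Def. 1.1] -/
theorem classX3Gord_bsdp_rankOne_of_chiBranchLower_of_cycLineFact_of_wuthrichHalf
    (hW16 : Wuthrich2014.thm16_halfEigenCharIdeal_dvd_cyclotomicPrime)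
    (hMaz : Mazur1972.cor515_universalNormIndex) (hCyc : delbourgoDatum_cycLineGrossZagier)
    (hArt : rankinSelbergEulerProductHecke_baseChangeDirichlet_eq) (h73 : GrossZagier1986_thm_I_7_3)
    (hWald : waldspurger_exists_heegnerField_twist_ne_zero) (hDel : Delbourgo2002.mainTheorem)
    (hmod : hasEntireLFunction_rat) (hmodD : nonempty_modularParametrizationData)
    (hmodN : exists_isNewformOf) (hGZK : rank_eq_analyticRank_of_analyticRank_le_one)
    (hX : ClassX3Gord W p) (he : semistabilityIndex W p = 2) (hp4 : p % 4 = 1) (hcm : ¬ W.HasCM)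
    (hr : W.analyticRank = 1) (hdiv : ChiBranchLowerDivisibilityAt W p) (hne : BranchCoeffOneNeZeroAt W p) :
    BSDp W p := by
  have hp2 : p ≠ 2 := by omega
  obtain ⟨V, iV, iVm, C, hV, hC⟩ := hX.exists_goodOrd_pStar_twist_model W p hp2 he
  have hordin : IsOrdinaryAt V p := ⟨hV.1, hV.2⟩
  haveI : NeZero (V.conductorNorm ℤ) := ⟨(V.conductorNorm_pos_holds).ne'⟩
  obtain ⟨Dm⟩ := hmodD V
  obtain ⟨ϖ, -, hϖ, -⟩ := Dm.exists_rat_mul_realPeriodRat_eq_plusPeriod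
  obtain ⟨Dh, hBι, hB, u, q, hlead, hpgz⟩ := exists_datum_identity_of_facts hCyc hArt h73 hWald hmod hmodD
    hmodN hGZK hX.addv hX.typeGOrd hp4 hcm hr V C hV hC Dm.isNewformOf ϖ hϖ
  have hl : MissingLowerBoundAt W p :=
    missingLowerBoundAt_rankOne_of_model_of_identity_of_chiBranchLower_of_branchCoeffOneNeZero hMaz hDel
      hmod hGZK hX.addv hX.typeGOrd hp4 hcm hr V C hV hC Dm.f Dm.isNewformOf ϖ hϖ hBι hlead hpgz hdiv hne
  have hSch : SchneiderConjecture Dh :=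
    schneiderConjecture_of_identity_of_branchCoeffOneNeZero hp4 hne V C hC hordin Dm.f Dm.isNewformOf ϖ
      hϖ hpgz
  have hu : MissingUpperBoundAt W p :=
    ClassX3Gord.missingUpperBoundAt_rankOne_of_wuthrichHalf_of_identity hW16 hGZK hmod hX hp4 hr hB hSch V hV
      C hC Dm.isNewformOf ϖ hϖ hlead hpgz
  exact bsdp_of_missingPPartAt W p hGZK (by rw [hr]) (missingPPartAt_of_lower_of_upper W p hl hu)

/-- **X3♯(G-ord) ∩ `I₀*`, `p ≡ 3 (mod 4)`, `p ≥ 7`, non-CM, `r_an = 1`, anomalous or not, line datum OR NOT: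
`BSD(E,p)` from the per-pair odd Λ-adic input `ChiBranchLowerDivisibilityOddAt W p` (DISPLAYED), PUBLISHED
facts (`hW16` for the upper half; `hMaz hCyc hArt h73 hWald hDel`, modularity, GZK) and
`BranchCoeffOneNeZeroAt W p`** — odd twin of the previous theorem (gz's `…_of_identity_odd` upper half).
[cite: Wuthrich2014, Thm. 16 (p. 397)] [cite: Delbourgo2002, Theorem (A), (B) (p. 40), p. 67 (iv), p. 69]
[cite: Mazur1972Towers, Cor. 5.15] [cite: Miller2011LMS, Def. 1.1] -/
theorem classX3Gord_bsdp_rankOne_odd_of_chiBranchLowerOdd_of_cycLineFact_of_wuthrichHalf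
    (hW16 : Wuthrich2014.thm16_halfEigenCharIdeal_dvd_cyclotomicPrime)
    (hMaz : Mazur1972.cor515_universalNormIndex) (hCyc : delbourgoDatum_cycLineGrossZagier)
    (hArt : rankinSelbergEulerProductHecke_baseChangeDirichlet_eq) (h73 : GrossZagier1986_thm_I_7_3)
    (hWald : waldspurger_exists_heegnerField_twist_ne_zero) (hDel : Delbourgo2002.mainTheorem)
    (hmod : hasEntireLFunction_rat) (hmodD : nonempty_modularParametrizationData)
    (hmodN : exists_isNewformOf) (hGZK : rank_eq_analyticRank_of_analyticRank_le_one)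
    (hX : ClassX3Gord W p) (he : semistabilityIndex W p = 2) (hp4 : p % 4 = 3) (hp5 : 5 ≤ p)
    (hcm : ¬ W.HasCM) (hr : W.analyticRank = 1) (hdiv : ChiBranchLowerDivisibilityOddAt W p)
    (hne : BranchCoeffOneNeZeroAt W p) : BSDp W p := by
  have hp2 : p ≠ 2 := by omega
  obtain ⟨V, iV, iVm, C, hV, hC⟩ := hX.exists_goodOrd_pStar_twist_model W p hp2 he
  have hordin : IsOrdinaryAt V p := ⟨hV.1, hV.2⟩
  haveI : NeZero (V.conductorNorm ℤ) := ⟨(V.conductorNorm_pos_holds).ne'⟩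
  obtain ⟨Dm⟩ := hmodD V
  obtain ⟨ϖ, -, hϖ⟩ := exists_rat_mul_imaginaryPeriodRat_eq_minusPeriod Dm
  obtain ⟨Dh, hBι, hB, u, q, hlead, hpgz⟩ := exists_datum_identity_odd_of_facts hCyc hArt h73 hWald hmod
    hmodD hmodN hGZK hX.addv hX.typeGOrd hp4 hp5 hcm hr V C hV hC Dm.isNewformOf ϖ hϖ
  have hl : MissingLowerBoundAt W p :=
    missingLowerBoundAt_rankOne_odd_of_model_of_identity_of_chiBranchLowerOdd_of_branchCoeffOneNeZero hMaz
      hDel hmod hGZK hX.addv hX.typeGOrd hp4 hp5 hcm hr V C hV hC Dm.f Dm.isNewformOf ϖ hϖ hBι hlead hpgz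
      hdiv hne
  have hSch : SchneiderConjecture Dh :=
    schneiderConjecture_of_identity_of_branchCoeffOneNeZero_odd hp4 hne V C hC hordin Dm.f Dm.isNewformOf ϖ
      hϖ hpgz
  have hu : MissingUpperBoundAt W p :=
    ClassX3Gord.missingUpperBoundAt_rankOne_of_wuthrichHalf_of_identity_odd hW16 hGZK hmod hX hp4 hr hB hSch
      V hV C hC Dm.isNewformOf ϖ hϖ hlead hpgz
  exact bsdp_of_missingPPartAt W p hGZK (by rw [hr]) (missingPPartAt_of_lower_of_upper W p hl hu)

/-- **X3♯(G-ord) at `p = 3` (`e = 2` automatic), non-CM, `r_an = 1`, ANOMALOUS OR NOT, line datum OR NOT: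
`BSD(E,3)` from the per-pair odd Λ-adic input `ChiBranchLowerDivisibilityOddAt W 3` (DISPLAYED), PUBLISHED facts
(`hW16` for the upper half; `hMaz`, lit's `p = 3` (B♮) fact `hCyc3`, `hArt h73 hWald`, Delbourgo 2002 at `3`
`hDel3`, modularity, GZK) and `BranchCoeffOneNeZeroAt W 3`** — the `p = 3` twin (gz's `…ThreeIntrinsic` road
re-keyed: `…CruxShape` §0 identity, hna-free lower core inline, `…_of_identity_odd` upper half).
[cite: Wuthrich2014, Thm. 16 (p. 397)] [cite: Delbourgo2002, Theorem (A), (B) (p. 40), p. 67 (iv), p. 69; Hypothesis (p. 39)]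
[cite: Mazur1972Towers, Cor. 5.15] [cite: Miller2011LMS, Def. 1.1] -/
theorem classX3Gord_bsdp_rankOne_three_of_chiBranchLowerOdd_of_cycLineFactThree_of_wuthrichHalf
    [Fact (Nat.Prime 3)] {W : WeierstrassCurve ℚ} [W.IsElliptic] [W.IsGloballyMinimal]
    (hW16 : Wuthrich2014.thm16_halfEigenCharIdeal_dvd_cyclotomicPrime)
    (hMaz : Mazur1972.cor515_universalNormIndex) (hCyc3 : delbourgoDatum_cycLineGrossZagier_intrinsicThree)
    (hArt : rankinSelbergEulerProductHecke_baseChangeDirichlet_eq) (h73 : GrossZagier1986_thm_I_7_3)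
    (hWald : waldspurger_exists_heegnerField_twist_ne_zero) (hDel3 : Delbourgo2002.mainTheorem_three)
    (hmod : hasEntireLFunction_rat) (hmodD : nonempty_modularParametrizationData)
    (hmodN : exists_isNewformOf) (hGZK : rank_eq_analyticRank_of_analyticRank_le_one)
    (hX : ClassX3Gord W 3) (hcm : ¬ W.HasCM) (hr : W.analyticRank = 1)
    (hdiv : ChiBranchLowerDivisibilityOddAt W 3) (hne : BranchCoeffOneNeZeroAt W 3) : BSDp W 3 := by
  have hp4 : (3 : ℕ) % 4 = 3 := by norm_num
  have hp2 : (3 : ℕ) ≠ 2 := by norm_num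
  have he : semistabilityIndex W 3 = 2 :=
    semistabilityIndex_eq_two_of_typeG_three W hX.typeGOrd.typeG hX.addv
  have hc : N10.CellGordTwo W 3 := ⟨hp2, hX.addv, hX.typeGOrd, he⟩
  obtain ⟨V, iV, iVm, C, hV, hC⟩ := hX.exists_goodOrd_pStar_twist_model W 3 hp2 he
  have hordin : IsOrdinaryAt V 3 := ⟨hV.1, hV.2⟩
  haveI : NeZero (V.conductorNorm ℤ) := ⟨(V.conductorNorm_pos_holds).ne'⟩
  obtain ⟨Dm⟩ := hmodD V
  obtain ⟨ϖ, -, hϖ⟩ := exists_rat_mul_imaginaryPeriodRat_eq_minusPeriod Dm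
  obtain ⟨Dh, -, hB, u, q, hlead, hpgz⟩ := exists_datum_identity_three_intrinsic_of_facts hCyc3 hArt h73
    hWald hmod hmodD hmodN hGZK hX.addv hX.typeGOrd hcm hr V C hV hC Dm.isNewformOf ϖ hϖ
  have hl : MissingLowerBoundAt W 3 :=
    cellGordTwo_missingLowerBoundAt_rankOne_three_intrinsic_of_facts_of_chiBranchLowerOdd_of_branchCoeffOneNeZero
      hMaz hCyc3 hArt h73 hWald hDel3 hmod hmodD hmodN hGZK hc hcm hr hdiv hne
  have hSch : SchneiderConjecture Dh :=
    schneiderConjecture_of_identity_of_branchCoeffOneNeZero_odd hp4 hne V C hC hordin Dm.f Dm.isNewformOf ϖ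
      hϖ hpgz
  have hu : MissingUpperBoundAt W 3 :=
    ClassX3Gord.missingUpperBoundAt_rankOne_of_wuthrichHalf_of_identity_odd hW16 hGZK hmod hX hp4 hr hB hSch
      V hV C hC Dm.isNewformOf ϖ hϖ hlead hpgz
  exact bsdp_of_missingPPartAt W 3 hGZK (by rw [hr]) (missingPPartAt_of_lower_of_upper W 3 hl hu)

/-! ### §4 (appended) THE CRUX SHAPE WITH THE CERTIFICATE AT THE PAIR ON EVERY ROW — CM rows discharged
(sibling `…GordTwoRankOneCM.lean`, Li–Liu–Tian 2024), non-CM rows via §2 -/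

/-- **Crux `GordTwoRankOne` (item 19358) MODULO EXACTLY (R1) and (R2).** E74's crux shape
(`…Certificate.gordTwoRankOne_of_facts_of_chiBranchLower_of_branchCoeffOneNeZero`: twenty PUBLISHED named
facts, the DISPLAYED rank-free Λ-adic branch lower containment on the off-Case-1 slice per parity `hΛ`/`hΛ'`
= items 19244/19245's layer — NOT in print, NOT asserted — and the per-pair certificate) PLUS ONE MORE
PUBLISHED fact, Li–Liu–Tian 2024 Thm. 1.1 (i) (`hLLT`): for every globally minimal `E/ℚ` of analytic rank `1`
and every (G-ord, `e = 2`) additive odd prime `p` — CM OR NOT, anomalous or not, any residual image — IF the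
branch certificate `A′ ≠ 0` holds WHEN `E` is non-CM (`¬ W.HasCM → BranchCoeffOneNeZeroAt W p`; vacuous on CM
rows), THEN `ord_p #Ш(E)_an ≤ ord_p #Ш(E)`. Excluded middle on `W.HasCM`: the sibling file's
`gordTwoRankOne_cm_of_liLiuTian` / §2 above (its Case-1 branch uses §1's isogeny invariance of `A′`, which is
why this per-pair form lives here and not in the sibling). Against the route decl `GordTwoRankOne` the residual
inputs are now EXACTLY `hΛ`, `hΛ'` and the certificate on non-CM pairs.
Nothing here discharges those; nothing booked. [cite: LiLiuTian2024, Thm. 1.1 (i)]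
[cite: Delbourgo2002, Theorem (A), (B) (p. 40), p. 58, p. 67 (iv), p. 69] [cite: Disegni2017, Theorem A/B (arXiv v3 PDF 7–9)]
[cite: Mazur1972Towers, Cor. 5.15] [cite: MilneADT2006, Thm. I.7.3]
[cite: SkinnerUrban2014, Cor. 3.6.3, Thm. 3.6.4 (pp. 42–43) (shape only; nothing asserted)] [cite: Miller2011LMS, Def. 1.1] -/
theorem gordTwoRankOne_of_facts_of_chiBranchLower_of_branchCoeffOneNeZero_of_liLiuTian
    (hW16 : Wuthrich2014.thm16_halfEigenCharIdeal_dvd_cyclotomicPrime)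
    (hGV : thm312_branch_unitContent_and_lambda_eq_residual_goodOrd)
    (h23 : datumSelmer_nonPrimitive_invariants)
    (h414 : Greenberg1999.prop414_noFiniteSubmodule_of_not_dvd_torsionOrder)
    (hGrK : Greenberg1999.imKummer_ge_strictCondition_goodOrdinary)
    (hLiftF : residualEpsilon_surjOn_of_lineRamifiedEven) (hLiftE : residualEpsilon_surjOn_of_lineEven)
    (hMaz : Mazur1972.cor515_universalNormIndex) (hCyc : delbourgoDatum_cycLineGrossZagier)
    (hCyc3 : delbourgoDatum_cycLineGrossZagier_intrinsicThree)
    (hArt : rankinSelbergEulerProductHecke_baseChangeDirichlet_eq) (h73 : GrossZagier1986_thm_I_7_3)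
    (hWald : waldspurger_exists_heegnerField_twist_ne_zero) (hDel : Delbourgo2002.mainTheorem)
    (hDel3 : Delbourgo2002.mainTheorem_three)
    (hmod : hasEntireLFunction_rat) (hmodD : nonempty_modularParametrizationData)
    (hmodN : exists_isNewformOf) (hGZK : rank_eq_analyticRank_of_analyticRank_le_one)
    (hCassels : bsdRHS_eq_of_isIsogenous) (hLLT : LiLiuTian2024.thm11_bsdp_of_cm_rank_one)
    (hΛ : ∀ (W : WeierstrassCurve ℚ) [W.IsElliptic] [W.IsGloballyMinimal] (p : ℕ) [Fact p.Prime],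
      N10.CellGordTwo W p → ¬ HasCaseOneMember W p → p % 4 = 1 → ChiBranchLowerDivisibilityAt W p)
    (hΛ' : ∀ (W : WeierstrassCurve ℚ) [W.IsElliptic] [W.IsGloballyMinimal] (p : ℕ) [Fact p.Prime],
      N10.CellGordTwo W p → ¬ HasCaseOneMember W p → p % 4 = 3 → ChiBranchLowerDivisibilityOddAt W p) :
    ∀ (W : WeierstrassCurve ℚ) [W.IsElliptic] [W.IsGloballyMinimal] (p : ℕ) [Fact p.Prime],
      W.analyticRank = 1 → N10.CellGordTwo W p → (¬ W.HasCM → BranchCoeffOneNeZeroAt W p) →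
      MissingLowerBoundAt W p := by
  intro W _ _ p _ hr hc hne
  by_cases hcm : W.HasCM
  · exact gordTwoRankOne_cm_of_liLiuTian hLLT W p hr hc hcm
  · exact gordTwoRankOne_of_facts_of_chiBranchLower_of_branchCoeffOneNeZero hW16 hGV h23 h414 hGrK hLiftF
      hLiftE hMaz hCyc hCyc3 hArt h73 hWald hDel hDel3 hmod hmodD hmodN hGZK hCassels hΛ hΛ' W p hr hc hcm
      (hne hcm)

end Summit.BirchSwinnertonDyer.BirchSwinnertonDyer.Theorems.AdditiveBranchIMCGordTwoRankOne

end
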